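import Summits.Ventures.PercRepro.LemmaBPlusK5Def

/-!
# Faces of `K₅`: kernel slices 20 … 23 (part F)

Each theorem is one `decide +kernel` at default heartbeats (≈ 55 s: the 1024-row table of the marking
plus ≤ 22 000 face points in sub-mask loops); generated by `tools/gen_k5.py`.
-/

namespace PercRepro

namespace Examples

open MultiGraph

/-- Slice 20: joins `u ∈ [758, 764)` of the faces of `K₅` (20412 face points). -/
theorem k5_slice_20 : k5.FacesSRange ![0, 1, 2, 3] 758 764 := by decide +kernel

/-- Slice 21: joins `u ∈ [764, 767)` of the faces of `K₅` (15309 face points). -/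
theorem k5_slice_21 : k5.FacesSRange ![0, 1, 2, 3] 764 767 := by decide +kernel

/-- Slice 22: joins `u ∈ [767, 784)` of the faces of `K₅` (21987 face points). -/
theorem k5_slice_22 : k5.FacesSRange ![0, 1, 2, 3] 767 784 := by decide +kernel

/-- Slice 23: joins `u ∈ [784, 827)` of the faces of `K₅` (20709 face points). -/
theorem k5_slice_23 : k5.FacesSRange ![0, 1, 2, 3] 784 827 := by decide +kernel

end Examples

end PercRepro
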